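import Literature.AlgebraicGeometry.HodgeTheory.AbsoluteHodgeClasses
import Literature.NumberTheory.Transcendental.AnalytificationExistenceProofs
import Literature.NumberTheory.Transcendental.AnalytificationCompactProofs
import HarnessLib

/-!
# Existence of conjugation charts and of conjugate classes: reduction to four printed theorems

Companion to `AbsoluteHodgeClasses` (Charles–Schnell, *Notes on absolute Hodge classes*, §11.2.2), whose
module docstring (junk analysis (3)) records that `IsConjugateClass σ X k c c'` — "`c'` is THE `σ`-conjugate
of `c`", an `∃` over conjugation charts — is NON-VACUOUS for `X` smooth projective "by Jouanolou + GAGA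
(`exists_isAnalytification`) + de Rham's theorem + Grothendieck's comparison — theorems not yet in the
tree". This file makes that sentence precise and kernel-checked:

* PROVED (§1): **analytic models exist** for every smooth separated quasi-compact `ℂ`-scheme of
  relative dimension `m`, in particular for smooth affine ones (`nonempty_analyticModel`,
  `nonempty_analyticModel_of_isAffine`) — assembled from the tree's proved analytification theorem
  `Literature.NumberTheory.Transcendental.exists_isAnalytification_holds` (Serre, GAGA §2), its second
  countability (`IsAnalytification.secondCountableTopology_of_compactSpace`) and the real structure
  underlying a holomorphic atlas (`Literature.Geometry.Kaehler.isManifold_real_of_isManifold_complex`);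
  and the conjugate `Y^σ` of a smooth affine `Y` is smooth affine of the same dimension (instances).
* STATED as named facts (§2), in the vocabulary of `AbsoluteHodgeClasses`, the four printed inputs:
  (J) `jouanolou_cohomologyChart` — Jouanolou's device in cohomological form: a smooth projective `X/ℂ`
  receives a `ℂ`-morphism `π : Y ⟶ X` from a smooth AFFINE `Y` with `π^*` and all `(π^σ)^*` bijective on
  `Hᵏ(–(ℂ); ℂ)` [Jouanolou 1973, Lemme 1.5: `Y` an affine torsor under a vector bundle; an affine-space
  bundle over a paracompact base is a homotopy equivalence (Dold 1963, Thm. 6.3), and `Y^σ → X^σ` is again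
  such a torsor]; (R) `exists_isRational_complexDeRhamIsoFamily` — de Rham's theorem with its periods: a
  NATURAL complex de Rham family which is RATIONALLY NORMALISED in every degree (the integration family:
  the class of a constant form on a torus `E/Λ` has periods its values on lattice tuples)
  [Griffiths–Harris, Ch. 2 §6; Bott–Tu §I.5]; (G) `grothendieck_comparison_realize_surjective` —
  Grothendieck's algebraic de Rham theorem on a smooth affine `Y`, surjectivity half, in the
  `AlgFormExpr.realize` language: every class of `H^k_dR(Y^an; ℂ)` is the class of the realisation of an
  algebraic `k`-form expression [Grothendieck 1966, Thm. 1']; (C) `conj_realize_mem_cclosedSmoothForms` —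
  the conjugate expression of an expression with closed realisation has closed realisation on `(Y^σ)^an`
  [Charles–Schnell (11.2.2): `α ↦ α^σ` is an isomorphism of algebraic de Rham COMPLEXES; injectivity of
  algebraic into analytic forms on a smooth `Y`, Serre GAGA §2 / Grothendieck 1966].
* PROVED (§3): from (J) and (R), **conjugation charts exist** (`nonempty_conjugationChart_of_facts`); from
  (J), (R), (G), (C), **conjugate classes exist**: for `X` smooth projective, every `σ ∈ Aut ℂ`, `k` and
  `c ∈ Hᵏ(X(ℂ); ℂ)` there is `c'` with `IsConjugateClass σ X k c c'` (`exists_isConjugateClass_of_facts`) —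
  the existence conjunct of `IsAbsoluteHodgeClass`, and verbatim the infrastructure stub shared by the
  absolute-Hodge lines of the Hodge programme.

Design: the four facts are CLOSED `Prop`s so that consumers state `theorem foo (hJ : …) (hR : …) … ` and
the discharge of each is an independent target. (J) deliberately bundles the algebro-geometric existence
(no notion of affine torsor is needed downstream) with its only use, the cohomological one; (R) is
existential (the witness is the complexified integration family of
`Literature.NumberTheory.Transcendental.DeRhamTheoremProofs`, natural by
`exists_complexDeRhamIsoFamily_holds`; what remains is the period computation on tori).

Not here: uniqueness of the conjugate (single-valuedness of charts; `AbsoluteHodgeClasses`, junk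
analysis (1)–(2)), "cycle classes are absolute Hodge", Principle B.

## References

* J.-P. Jouanolou, *Une suite exacte de Mayer–Vietoris en K-théorie algébrique*, LNM 341 (1973), Lemme 1.5.
* A. Dold, *Partitions of unity in the theory of fibrations*, Ann. of Math. 78 (1963), Thm. 6.3.
* A. Grothendieck, *On the de Rham cohomology of algebraic varieties*, Publ. IHÉS 29 (1966), Thm. 1'.
* F. Charles, C. Schnell, *Notes on absolute Hodge classes* (2014), §11.2.2, (11.2.1)–(11.2.3).
* P. Griffiths, J. Harris, *Principles of Algebraic Geometry* (1978), Ch. 2 §6 (complex tori).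
* R. Bott, L. Tu, *Differential Forms in Algebraic Topology* (1982), §I.5.
* J.-P. Serre, *GAGA*, Ann. Inst. Fourier 6 (1956), §2.
-/

noncomputable section

open scoped Manifold ContDiff
open CategoryTheory AlgebraicGeometry
open Literature.NumberTheory.Transcendental Literature.Geometry.Kaehler
open Literature.AlgebraicTopology.SingularHomology

namespace Literature.AlgebraicGeometry.HodgeTheory

section HodgeTheory

/-! ### §1 Analytic models of smooth quasi-compact separated schemes; conjugates of smooth affines -/

/-- **Analytic models exist** for a smooth, separated `ℂ`-scheme `Y` of relative dimension `m`, locally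
of finite type with quasi-compact underlying space: Serre's analytification `Y^an → Y(ℂ)`
(`exists_isAnalytification_holds`, charted on `ℂᵐ`), which is Hausdorff, second countable
(`IsAnalytification.secondCountableTopology_of_compactSpace`) and locally compact, hence σ-compact, with
the real `C^∞` structure underlying its holomorphic atlas. [cite: SerreGAGA1956, §2 n°5 Prop. 2] -/
theorem nonempty_analyticModel (m : ℕ) (Y : Motives.SchemeOver ℂ) [LocallyOfFiniteType Y.hom]
    [SmoothOfRelativeDimension m Y.hom] [IsSeparated Y.hom] [CompactSpace Y.left] :
    Nonempty (AnalyticModel (Fin m → ℂ) m Y) := by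
  obtain ⟨M, _, _, _, _, φ, hφ⟩ := exists_isAnalytification_holds Y m
  haveI := isManifold_real_of_isManifold_complex (E := Fin m → ℂ) (M := M)
  haveI : SecondCountableTopology M := hφ.secondCountableTopology_of_compactSpace
  haveI : LocallyCompactSpace M := ChartedSpace.locallyCompactSpace (Fin m → ℂ) M
  exact ⟨{ carrier := M, toComplexPoints := φ, isAnalytification := hφ }⟩

/-- **Analytic models of smooth affine schemes exist**: an affine `Y` is quasi-compact and separated
over `ℂ`, and smooth morphisms are locally of finite type. [cite: SerreGAGA1956, §2 n°5 Prop. 2] -/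
theorem nonempty_analyticModel_of_isAffine (m : ℕ) (Y : Motives.SchemeOver ℂ) [IsAffine Y.left]
    [SmoothOfRelativeDimension m Y.hom] : Nonempty (AnalyticModel (Fin m → ℂ) m Y) := by
  haveI : Smooth Y.hom := SmoothOfRelativeDimension.smooth m Y.hom
  haveI : IsSeparated Y.hom := IsSeparated.of_isAffineHom Y.hom
  exact nonempty_analyticModel m Y

/-- The conjugate `Y^σ = Y ×_{ℂ,σ} ℂ` of an affine `ℂ`-scheme is affine (a fibre product of affine
schemes). [cite: CharlesSchnell2014Notes, §11.2.2 (11.2.1)] -/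
instance isAffine_conjugateVariety_left (σ : ℂ ≃+* ℂ) (Y : Motives.SchemeOver ℂ) [IsAffine Y.left] :
    IsAffine (Motives.conjugateVariety σ Y).left := by
  change IsAffine (Limits.pullback Y.hom (Spec.map (CommRingCat.ofHom σ.toRingHom)))
  infer_instance

/-- The conjugate `Y^σ` of a `ℂ`-scheme smooth of relative dimension `m` is smooth of relative
dimension `m` (base change). [cite: CharlesSchnell2014Notes, §11.2.2 (11.2.1)] -/
instance smoothOfRelativeDimension_conjugateVariety_hom (σ : ℂ ≃+* ℂ) (m : ℕ)
    (Y : Motives.SchemeOver ℂ) [SmoothOfRelativeDimension m Y.hom] :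
    SmoothOfRelativeDimension m (Motives.conjugateVariety σ Y).hom := by
  change SmoothOfRelativeDimension m
    (Limits.pullback.snd Y.hom (Spec.map (CommRingCat.ofHom σ.toRingHom)))
  haveI := smoothOfRelativeDimension_isStableUnderBaseChange (n := m)
  exact MorphismProperty.pullback_snd _ _ ‹_›

namespace AnalyticModel

variable {E : Type} [NormedAddCommGroup E] [NormedSpace ℂ E] [FiniteDimensional ℂ E] {m : ℕ}
  {Y : Motives.SchemeOver ℂ} (A : AnalyticModel E m Y)

/-- The comparison map of an analytic model as a homeomorphism `Y^an ≃ₜ Y(ℂ)`. [cite: SerreGAGA1956, §2] -/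
def homeomorph : A.carrier ≃ₜ Motives.ComplexPoints Y :=
  A.isAnalytification.homeomorph

/-- The pull-back `Hᵏ(Y(ℂ); ℂ) ⟶ Hᵏ(Y^an; ℂ)` of an analytic model is the isomorphism induced by the
homeomorphism `Y^an ≃ₜ Y(ℂ)`. [cite: SerreGAGA1956, §2] -/
theorem pullback_eq_mapIso_hom (k : ℕ) :
    A.pullback k = (singularCohomology.mapIso ℂ ℂ A.homeomorph k).hom := by
  rw [singularCohomology.mapIso_hom]
  rfl

/-- The pull-back `Hᵏ(Y(ℂ); ℂ) → Hᵏ(Y^an; ℂ)` along the comparison map is surjective. [cite: SerreGAGA1956, §2] -/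
theorem pullback_surjective (k : ℕ) : Function.Surjective (A.pullback k) := by
  rw [pullback_eq_mapIso_hom]
  exact (singularCohomology.mapIso ℂ ℂ A.homeomorph k).toLinearEquiv.surjective

/-- The pull-back `Hᵏ(Y(ℂ); ℂ) → Hᵏ(Y^an; ℂ)` along the comparison map is injective. [cite: SerreGAGA1956, §2] -/
theorem pullback_injective (k : ℕ) : Function.Injective (A.pullback k) := by
  rw [pullback_eq_mapIso_hom]
  exact (singularCohomology.mapIso ℂ ℂ A.homeomorph k).toLinearEquiv.injective

end AnalyticModel

/-! ### §2 The four printed inputs, as named facts -/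

/-- **Jouanolou's device, cohomological form** (named fact). For `X` smooth projective over `ℂ` there
are a smooth AFFINE `ℂ`-scheme `Y` (of some relative dimension `m`) and a `ℂ`-morphism `π : Y ⟶ X` such
that `π^* : Hᵏ(X(ℂ); ℂ) → Hᵏ(Y(ℂ); ℂ)` is bijective for every `k`, and so is `(π^σ)^*` on the conjugates
for every `σ ∈ Aut ℂ`. Jouanolou (1973), Lemme 1.5: a quasi-projective `X` carries a torsor `Y → X` under a
vector bundle with `Y` affine (for `X = ℙᴺ`: the variety of rank-one idempotents of `M_{N+1}`; in general
its restriction to `X ↪ ℙᴺ`), smooth over `ℂ` when `X` is; on complex points `Y(ℂ) → X(ℂ)` is a locally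
trivial bundle of affine spaces over a compact Hausdorff base, hence a homotopy equivalence (Dold 1963,
Thm. 6.3), so `π^*` is bijective on singular cohomology; `π^σ : Y^σ → X^σ` is the same kind of torsor
over the smooth projective `X^σ`. Stated with exactly the data consumed by `ConjugationChart`.
[cite: Jouanolou1973, Lemme 1.5] -/
def jouanolou_cohomologyChart : Prop :=
  ∀ ⦃n : ℕ⦄ ⦃X : Motives.SchemeOver ℂ⦄, Motives.IsSmoothProjective n X →
    ∃ (m : ℕ) (Y : Motives.SchemeOver ℂ) (_ : IsAffine Y.left) (_ : SmoothOfRelativeDimension m Y.hom)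
      (π : Y ⟶ X), ∀ k : ℕ, Function.Bijective (complexBetti.map π k) ∧
        ∀ σ : ℂ ≃+* ℂ, Function.Bijective (complexBetti.map (conjHom σ π) k)

/-- **de Rham's theorem with rational periods on tori** (named fact). For every finite-dimensional
complex model space `E` there is a complex de Rham isomorphism family over the Hausdorff σ-compact
real-`C^∞` manifolds charted on `E` which is NATURAL (`ComplexDeRhamIsoFamily.IsNatural`) and RATIONALLY
NORMALISED in every degree (`IsRationalDeRhamFamily`: on a torus `E/Φ(ℤ^ι)` the class of a constant
`k`-form with rational values on the `k`-tuples of lattice basis vectors is a rational class). Witness: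
the integration family `[ω] ↦ (σ ↦ ∫_σ ω)` (complexified), natural by de Rham's theorem (in the tree:
`exists_complexDeRhamIsoFamily_holds`) and with these periods because `H_k(E/Λ; ℤ) = ⋀ᵏ Λ` is spanned by
the coordinate sub-tori, on which a constant form integrates to its value on the corresponding lattice
tuple (Griffiths–Harris, Ch. 2 §6, "Complex tori", pp. 300–302; Bott–Tu §I.5).
[cite: GriffithsHarris1978, Ch. 2 §6 (cohomology of complex tori)] -/
def exists_isRational_complexDeRhamIsoFamily : Prop :=
  ∀ (E : Type) [NormedAddCommGroup E] [NormedSpace ℂ E] [FiniteDimensional ℂ E],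
    ∃ e : ComplexDeRhamIsoFamily E, e.IsNatural ∧ ∀ k : ℕ, IsRationalDeRhamFamily e k

/-- **Grothendieck's algebraic de Rham theorem on a smooth affine variety, surjectivity half, in the
language of form expressions** (named fact). For `Y` smooth affine over `ℂ` of relative dimension `m`
and any analytic model `A` of `Y` (charted on a finite-dimensional `E`), every class of the smooth
complex de Rham cohomology `H^k_dR(Y^an; ℂ)` (`complexDeRhamCohomology E A.carrier k`) is the class of the
realisation `ξ.realize A` of an algebraic `k`-form expression `ξ = ∑ⱼ fⱼ dg_{j,1} ∧ ⋯ ∧ dg_{j,k}`,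
`fⱼ, g_{j,i} ∈ Γ(Y, 𝒪)`, with closed realisation. Grothendieck (1966), Thm. 1': for `Y` smooth affine,
`H•(Γ(Y, Ω•_{Y/ℂ})) ⥲ H•(Y^an; ℂ)`; every element of `Ωᵏ_{A/ℂ} = ⋀ᵏ Ω¹_{A/ℂ}` (`A = Γ(Y, 𝒪)`,
`Ω¹` generated by the `dg`) is such a sum; and on the complex manifold `Y^an` the holomorphic and the
smooth complex de Rham complexes compute the same cohomology (`∂̄`-Poincaré lemma; `Y^an` Stein).
-- TODO(general form): the comparison is an isomorphism of graded algebras `H•_dR(Y/ℂ) ≅ H•(Y^an; ℂ)`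
-- for every smooth `Y` (hypercohomology); only surjectivity on a smooth affine is stated.
[cite: Grothendieck1966, Thm. 1'] -/
def grothendieck_comparison_realize_surjective : Prop :=
  ∀ (m : ℕ) (Y : Motives.SchemeOver ℂ) [IsAffine Y.left] [SmoothOfRelativeDimension m Y.hom]
    (E : Type) [NormedAddCommGroup E] [NormedSpace ℂ E] [FiniteDimensional ℂ E]
    (A : AnalyticModel E m Y) (k : ℕ) (x : complexDeRhamCohomology E A.carrier k),
    ∃ (ξ : AlgFormExpr Y k) (hξ : ξ.realize A ∈ cclosedSmoothForms E A.carrier k),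
      complexDeRhamCohomology.mk E A.carrier k ⟨ξ.realize A, hξ⟩ = x

/-- **Conjugation preserves closedness of algebraic forms** (named fact). For `Y` smooth affine over
`ℂ`, analytic models `A` of `Y` and `A'` of `Y^σ`, and an algebraic `k`-form expression `ξ` on `Y`: if the
realisation of `ξ` on `Y^an` is closed then so is the realisation on `(Y^σ)^an` of the conjugate
expression `ξ^σ` (`AlgFormExpr.conj`: coefficients and arguments pushed through the ring isomorphism
`Γ(Y, 𝒪) ≅ Γ(Y^σ, 𝒪)`). Charles–Schnell (2014), §11.2.2, (11.2.2): `α ↦ α^σ` is a (`σ`-linear) isomorphism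
of the algebraic de Rham COMPLEXES `Γ(Y, Ω•_{Y/ℂ}) ≅ Γ(Y^σ, Ω•_{Y^σ/ℂ})`, so `d(α^σ) = (dα)^σ`; and for smooth
`Y` the realisation `Γ(Y, Ω•_{Y/ℂ}) → A•(Y^an; ℂ)` is an injective map of differential graded algebras
(coherent sheaves inject into their analytifications, Serre GAGA §2; Grothendieck 1966, §1), so a closed
realisation means `dα = 0`, whence `d(α^σ) = 0` and the realisation of `ξ^σ` is closed.
[cite: CharlesSchnell2014Notes, §11.2.2 (11.2.2)] -/
def conj_realize_mem_cclosedSmoothForms : Prop :=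
  ∀ (σ : ℂ ≃+* ℂ) (m : ℕ) (Y : Motives.SchemeOver ℂ) [IsAffine Y.left]
    [SmoothOfRelativeDimension m Y.hom] (E : Type) [NormedAddCommGroup E] [NormedSpace ℂ E]
    [FiniteDimensional ℂ E] (A : AnalyticModel E m Y)
    (A' : AnalyticModel E m (Motives.conjugateVariety σ Y)) (k : ℕ) (ξ : AlgFormExpr Y k),
    ξ.realize A ∈ cclosedSmoothForms E A.carrier k →
      (ξ.conj σ).realize A' ∈ cclosedSmoothForms E A'.carrier k

/-! ### §3 Conjugation charts and conjugate classes exist -/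

/-- **Conjugation charts exist** (from (J) and (R)): for `X` smooth projective over `ℂ`, every
`σ ∈ Aut ℂ` and every degree `k` there is a conjugation chart for `(σ, X, k)` — Jouanolou's affine `Y → X`
with `(π^σ)^*` injective, the analytifications of `Y` and `Y^σ` charted on `ℂᵐ` (§1), and a natural
rationally normalised de Rham family on `ℂᵐ`-manifolds. [cite: Jouanolou1973, Lemme 1.5] -/
theorem nonempty_conjugationChart_of_facts (hJ : jouanolou_cohomologyChart)
    (hR : exists_isRational_complexDeRhamIsoFamily) {n : ℕ} {X : Motives.SchemeOver ℂ}
    (hX : Motives.IsSmoothProjective n X) (σ : ℂ ≃+* ℂ) (k : ℕ) :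
    Nonempty (ConjugationChart σ X k) := by
  obtain ⟨m, Y, _, _, π, hπ⟩ := hJ hX
  obtain ⟨A⟩ := nonempty_analyticModel_of_isAffine m Y
  obtain ⟨A'⟩ := nonempty_analyticModel_of_isAffine m (Motives.conjugateVariety σ Y)
  obtain ⟨e, he, hr⟩ := hR (Fin m → ℂ)
  exact
    ⟨{ m := m, Y := Y, π := π, E := Fin m → ℂ, an := A, anConj := A', deRham := e
       deRham_isNatural := he, deRham_isRational := hr k, injective_map := ((hπ k).2 σ).1 }⟩

/-- **Conjugate classes exist** (from (J), (R), (G), (C)). For `X` smooth projective over `ℂ`,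
`σ ∈ Aut ℂ`, `k` and `c ∈ Hᵏ(X(ℂ); ℂ)` there is a class `c' ∈ Hᵏ(X^σ(ℂ); ℂ)` conjugate to `c`
(`IsConjugateClass σ X k c c'`): in the chart of `nonempty_conjugationChart_of_facts`, represent `π^* c` on
`Y^an` by an algebraic form expression `ξ` (Grothendieck), realise the conjugate expression `ξ^σ` on
`(Y^σ)^an` (closed by (C)), read its class in `Hᵏ(Y^σ(ℂ); ℂ)` through the comparison homeomorphism, and
descend it along the bijection `(π^σ)^*`. This is Charles–Schnell's `α ↦ α^σ` ((11.2.2)–(11.2.3)) computed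
on Jouanolou's affine; it is the existence conjunct of `IsAbsoluteHodgeClass`.
[cite: CharlesSchnell2014Notes, §11.2.2 (11.2.3)] -/
theorem exists_isConjugateClass_of_facts (hJ : jouanolou_cohomologyChart)
    (hR : exists_isRational_complexDeRhamIsoFamily) (hG : grothendieck_comparison_realize_surjective)
    (hC : conj_realize_mem_cclosedSmoothForms) :
    ∀ ⦃n : ℕ⦄ ⦃X : Motives.SchemeOver ℂ⦄, Motives.IsSmoothProjective n X →
      ∀ (σ : ℂ ≃+* ℂ) (k : ℕ) (c : complexBetti X k), ∃ c', IsConjugateClass σ X k c c' := by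
  intro n X hX σ k c
  obtain ⟨m, Y, _, _, π, hπ⟩ := hJ hX
  obtain ⟨A⟩ := nonempty_analyticModel_of_isAffine m Y
  obtain ⟨A'⟩ := nonempty_analyticModel_of_isAffine m (Motives.conjugateVariety σ Y)
  obtain ⟨e, he, hr⟩ := hR (Fin m → ℂ)
  -- an algebraic form expression representing `π^* c` on `Y^an`
  obtain ⟨ξ, hξ, hx⟩ :=
    hG m Y (Fin m → ℂ) A k ((e A.carrier k).symm (A.pullback k (complexBetti.map π k c)))
  -- its conjugate expression has closed realisation on `(Y^σ)^an`
  have hξ' : (ξ.conj σ).realize A' ∈ cclosedSmoothForms (Fin m → ℂ) A'.carrier k :=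
    hC σ m Y (Fin m → ℂ) A A' k ξ hξ
  -- read the class of `ξ^σ` in `Hᵏ(Y^σ(ℂ); ℂ)` and descend it along `(π^σ)^*`
  obtain ⟨d, hd⟩ := A'.pullback_surjective k
    (e A'.carrier k (complexDeRhamCohomology.mk (Fin m → ℂ) A'.carrier k ⟨_, hξ'⟩))
  obtain ⟨c', hc'⟩ := ((hπ k).2 σ).2 d
  refine ⟨c',
    { m := m, Y := Y, π := π, E := Fin m → ℂ, an := A, anConj := A', deRham := e
      deRham_isNatural := he, deRham_isRational := hr k, injective_map := ((hπ k).2 σ).1 },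
    ξ, hξ, hξ', ?_, ?_⟩
  · show A.pullback k (complexBetti.map π k c) =
      e A.carrier k (complexDeRhamCohomology.mk (Fin m → ℂ) A.carrier k ⟨ξ.realize A, hξ⟩)
    rw [hx, LinearEquiv.apply_symm_apply]
  · show A'.pullback k (complexBetti.map (conjHom σ π) k c') =
      e A'.carrier k (complexDeRhamCohomology.mk (Fin m → ℂ) A'.carrier k ⟨(ξ.conj σ).realize A', hξ'⟩)
    rw [hc', hd]

end HodgeTheory

end Literature.AlgebraicGeometry.HodgeTheory

end
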